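import Summits.QuantumFields.BalabanUV.T4Continuum.Support.RegionGaugeResolventTower

/-!
# T⁴ programme, spine node NE2 (U1a), sub-row Δ1 «NE2⁰-Dirichlet» — LEAF (Bᵗ) OF THE RESOLVENT-SPLIT CUT FROM LEAF (B):
# `JᴴJ = 1 − (1 − L⁻¹)·P_def` and the deficient-layer trace of the gauge columns `‖P_def·B̂_k‖ ≤ √(2Λ/n_k)`

NE2 formalisation swarm `b2b-balaban-t4-ne2-formalise-*`, LEAF PROVER 06 (gen 7), supplier item «Δ1-VEC-BT-TRACE» (journal
2026-08-20 l.22425; owner rulings R35 (c) / R36 (a): first refusal of the leaf-06 lineage on the (Bᵗ) trace half).  Context: the row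
OWNER's resolvent split (`RegionGaugeResolventSplit` p238371, `RegionGaugeResolventTower` p238533) reduces King's compressed injected law
of the faithful `Δ_a(Ω₀)` on a coordinate box to FOUR displayed leaves (L) (B) (Bᵗ) (K) (`hinjK_of_local`).  THIS FILE discharges (Bᵗ)
from (B):

 * §1 ALGEBRA: `J = J̃·N⁻¹` and `J̃ᴴJ̃ = 1` give **`JpR_conjTranspose_mul_JpR`** `JᴴJ = N⁻² = 1 − (1 − L⁻¹)•P_def` (King's compressed
   planting restricted to the star carriers is an isometry on the REGULAR star bonds and loses the factor `L⁻¹` on the DEFICIENT ones — the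
   inward spikes, which have `L^{d−1}` instead of `L^d` star children); hence the split `JᴴB̂′ − B̂ = Jᴴ(B̂′ − J·B̂) − (1 − L⁻¹)•P_def·B̂` and
   **`opNorm_adjoint_defect_le`** `‖JᴴB̂′ − B̂‖ ≤ ‖B̂′ − J·B̂‖ + (1 − L⁻¹)·‖P_def·B̂‖`.
 * §2 THE TRACE OF THE GAUGE COLUMNS **`opNorm_defP_mul_regionBh_le`**: on a coordinate box, `‖P_def·B̂‖ ≤ √(2Λ/n)`, `Λ = Lam d a′ =
   γ′⁻¹ + 2(1 + (a′γ′⁻¹)²)` (gan24's budget constant).  `B̂c = √(n^d)·∂ψ̄` with `ψ̄` the zero-extended scalar box solution with source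
   `Q′_Ωᴴc`; up the column of `n` star bonds rising from an inward spike (gen 6's `RegionStarTrace.cpt`) the consecutive differences of
   `√(n^d)·∂_νψ̄` ARE `−n^{d/2−1}·(∂_νᴴ∂_νψ̄)` at INTERIOR sites (only DIAGONAL second differences; no mixed Hessian, no boundary kink), so
   `path_avg` + the disjointness of the columns give `n·Σ_def ‖B̂c‖² ≤ n^d·(2Σ_μ‖∂_μψ̄‖² + Σ_μ Σ_{x∈Ω}‖(∂_μᴴ∂_μψ̄)(x)‖²) ≤ 2·n^d·Σ_μ budget_μ(ψ̄)
   ≤ 2Λ·n^d·‖Q′_Ωᴴc‖² ≤ 2Λ·‖c‖²` by gan24's `DirichletBoxTwoLevel.sum_budget_solExt_le` (energy + corner-free discrete `H²`) BY NAME.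
 * §3 TOWER: **`hBt_of_hB`** — (B) at rate `θ ≥ (√L)⁻¹` ⟹ (Bᵗ) at the same rate with `Cbt = Cb + (1 − L⁻¹)√(2Λ)` (the trace term is
   `√(2Λ)·n_k^{−1/2} = √(2Λ)·((√L)⁻¹)^k`), **`hinjK_of_local3`** and the END **`towerLimitRate_star_renorm_box_of_local3`** = the owner's
   `towerLimitRate_star_renorm_box_of_local` with `hBt` DISCHARGED: the renormalised box star tower at `θ ∈ [(√L)⁻¹, 1)` MODULO THE THREE
   LEAVES (L) (B) (K).
   (K) is leaf-01-g10's THEOREM `RegionGramTwoLevel.opNorm_KcompR_inv_sub_le_lev` (p238963, torus rate), plugged by the owner's O15-c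
   `RegionLocalInjectedAssembly.hK_box`; the owner's END `towerLimitRate_star_renorm_box_of_WPairing` takes `hBt := hBt_of_hB … hB`.

HONEST FRAMING (T4-DAG p. 1).  [folklore] finite lattice calculus + finite-dimensional linear algebra over landed modules on the cell's typed
`U = 1` objects (ONE region = a coordinate box, ONE averaging scale, finite torus, linear layer, operator norm); constants OURS; (B) and (L)
enter as DISPLAYED hypotheses (crew items of leaf-05-g9 / leaf-03-g8 + leaf-02-g8 + leaf-07-g8), (K) is leaf-01-g10's theorem; the
trace rate `n_k^{−1/2}` is the honest one (owner R36 (c), gen 6's STARTOWER numerics); `hinjK` / W3 on boxes OPEN; Δ1 NOT closed; NE2 (U1a)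
NOT proved; spine PROVED 0/9 unchanged; NOT [B9] (3.16)/(3.23)–(3.27) as printed; NOT infinite volume / mass gap / Clay.  HONEST DEPENDENCY:
continuum YM on T⁴ ⇐ BetaPertH ∧ nine spine estimates (0/9 proved); BetaPertH ⇐ (D1) ∧ (D4) ∧ CAP+tail; G-an2-4 gates asym, D1 and NE2/3/4.
No `sorry`.
-/

noncomputable section

open scoped BigOperators ComplexConjugate Matrix Matrix.Norms.L2Operator
open Finset

namespace Summit.QuantumFields.BalabanUV.T4Continuum.RegionGaugeColumnsTrace

open Literature.MathematicalPhysics.QuantumFieldTheory.Balaban1983to89.B5Prop11Plancherel (Tor fine unitVec)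
open Literature.MathematicalPhysics.QuantumFieldTheory.Balaban1983to89.B5Prop11Lower (nsq nsq_nonneg)
open Literature.MathematicalPhysics.QuantumFieldTheory.Balaban1983to89.B5Action121 (sdiff GradOp GradOp_mulVec sdiff_mulVec)
open Literature.MathematicalPhysics.QuantumFieldTheory.Balaban1983to89.B5Block118 (tstep tstep_zero tstep_succ)
open Literature.MathematicalPhysics.QuantumFieldTheory.Balaban1983to89.B5G183RateUnitTower (lev)
open Summit.QuantumFields.BalabanUV.T4Continuum
open Summit.QuantumFields.BalabanUV.T4Continuum.SubtypeCompression (ext ext_apply_of ext_apply_of_not)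
open Summit.QuantumFields.BalabanUV.T4Continuum.ScalarAveragedPropagator (gammaPs gammaPs_pos opNorm_le_of_nsq_le_rect)
open Summit.QuantumFields.BalabanUV.T4Continuum.BalabanBlockPoincare (nsq_mulVec_le_rect)
open Summit.QuantumFields.BalabanUV.T4Continuum.RegionScalarCompression (QOm GOm KcompR)
open Summit.QuantumFields.BalabanUV.T4Continuum.RegionGaugeFixedVector (starReg gradR regionDeltaA)
open Summit.QuantumFields.BalabanUV.T4Continuum.RegionGaugeFixedVectorTop (gradR_mulVec)
open Summit.QuantumFields.BalabanUV.T4Continuum.RegionInteriorW2 (CgIbox opNorm_QOm_le)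
open Summit.QuantumFields.BalabanUV.T4Continuum.CovariantAveragingTower (TowerLimitRate)
open Summit.QuantumFields.BalabanUV.T4Continuum.BackgroundResolventTower (Cpert)
open Summit.QuantumFields.BalabanUV.T4Continuum.DirichletSubregionTowerOf (pidx JpR opNorm_JpR_le)
open Summit.QuantumFields.BalabanUV.T4Continuum.DirichletSubregionRenormTower (JnR AnR JnR_conjTranspose_mul_JnR)
open Summit.QuantumFields.BalabanUV.T4Continuum.DirichletStarVectorTower (starP gamStar)
open Summit.QuantumFields.BalabanUV.T4Continuum.DirichletStarRenormTower (nch_star_pos)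
open Summit.QuantumFields.BalabanUV.T4Continuum.DirichletStarRenormReduction (Nmat NmatInv nwt_eq JnR_eq_JpR_mul_Nmat Nmat_mul_NmatInv)
open Summit.QuantumFields.BalabanUV.T4Continuum.DirichletStarRenormBoxTower (sqrt_inv_lev)
open Summit.QuantumFields.BalabanUV.T4Continuum.RegionStarTrace (path_avg cpt defSet mem_defSet star_add_tstep blockReg_add_tstep_succ
  sum_columns_le defP nsq_defP_mulVec)
open Summit.QuantumFields.BalabanUV.T4Continuum.RegionSliceCoerciveBoxTower (cW1box)
open Summit.QuantumFields.BalabanUV.T4Continuum.RegionGaugeResolventSplit (gaugeB regionBh regionDeltaLoc)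
open Summit.QuantumFields.BalabanUV.T4Continuum.RegionGaugeResolventTower (C1loc hinjK_of_local towerLimitRate_star_renorm_box_of_local)
open Summit.QuantumFields.BalabanUV.Beta.GAN24.DirichletBoxTrace (blockReg)
open Summit.QuantumFields.BalabanUV.Beta.GAN24.DirichletBoxRegularity (Pdir Pdir_mulVec)
open Summit.QuantumFields.BalabanUV.Beta.GAN24.DirichletBoxCompression (DOm solExt)
open Summit.QuantumFields.BalabanUV.Beta.GAN24.DirichletBoxTwoLevel (IsCoordBox budget Lam Lam_nonneg sum_budget_solExt_le)

variable {d : ℕ}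

/-! ## §1 `JᴴJ = 1 − (1 − L⁻¹)•P_def` and the adjoint split -/

section Algebra

variable (L : ℕ) [NeZero L] (M : Fin d → ℕ) [hM : ∀ μ, NeZero (M μ)] (S : Tor M → Prop) [DecidablePred S]

/-- `J = J̃·N⁻¹` (King's compressed planting from the renormalised one). [folklore] -/
theorem JpR_eq_JnR_mul_NmatInv (hL : 1 ≤ L) (k : ℕ) :
    JpR L M (starP L M S) k = JnR L M (starP L M S) k * NmatInv L M S k := by
  rw [JnR_eq_JpR_mul_Nmat, Matrix.mul_assoc, Nmat_mul_NmatInv L M S hL k, Matrix.mul_one]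

/-- `(N⁻¹)ᴴ = N⁻¹` (real diagonal). [folklore] -/
theorem NmatInv_conjTranspose (k : ℕ) : (NmatInv L M S k)ᴴ = NmatInv L M S k := by
  unfold NmatInv
  rw [Matrix.diagonal_conjTranspose]
  congr 1; funext i
  rw [Pi.star_apply, Complex.star_def, Complex.conj_ofReal]

/-- `N⁻¹·N⁻¹ = 1 − (1 − L⁻¹)•P_def` (weights `1` on regular, `(√L)⁻¹` on deficient star bonds). [folklore] -/
theorem NmatInv_mul_NmatInv (k : ℕ) :
    NmatInv L M S k * NmatInv L M S k = 1 - (((1 - (L : ℝ)⁻¹ : ℝ)) : ℂ) • defP (lev L k) M S := by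
  have hL0 : (0 : ℝ) ≤ L := Nat.cast_nonneg L
  ext i j
  rw [NmatInv, Matrix.diagonal_mul_diagonal, defP, Matrix.sub_apply, Matrix.smul_apply, Matrix.one_apply, smul_eq_mul]
  by_cases hij : i = j
  · subst hij
    rw [Matrix.diagonal_apply_eq, Matrix.diagonal_apply_eq, if_pos rfl, nwt_eq]
    by_cases h : blockReg (lev L k) M S i.1.1
    · rw [if_pos h, if_pos h, mul_zero, sub_zero, inv_one, Complex.ofReal_one, mul_one]
    · rw [if_neg h, if_neg h, mul_one, ← Complex.ofReal_mul, ← mul_inv, Real.mul_self_sqrt hL0, ← Complex.ofReal_one,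
        ← Complex.ofReal_sub, sub_sub_cancel]
  · rw [Matrix.diagonal_apply_ne _ hij, Matrix.diagonal_apply_ne _ hij, if_neg hij, mul_zero, sub_zero]

/-- **`JᴴJ = 1 − (1 − L⁻¹)•P_def`**: King's compressed planting on the star carriers is an isometry on the regular star bonds and
loses `L⁻¹` on the deficient ones. [folklore] -/
theorem JpR_conjTranspose_mul_JpR (hL : 1 ≤ L) (k : ℕ) :
    (JpR L M (starP L M S) k)ᴴ * JpR L M (starP L M S) k = 1 - (((1 - (L : ℝ)⁻¹ : ℝ)) : ℂ) • defP (lev L k) M S := by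
  rw [JpR_eq_JnR_mul_NmatInv L M S hL k, Matrix.conjTranspose_mul, NmatInv_conjTranspose, Matrix.mul_assoc,
    ← Matrix.mul_assoc (JnR L M (starP L M S) k)ᴴ, JnR_conjTranspose_mul_JnR L M (starP L M S) (nch_star_pos L M S) k,
    Matrix.one_mul, NmatInv_mul_NmatInv]

omit [NeZero L] hM [DecidablePred S] in
/-- generic: `JᴴB′ − B = Jᴴ(B′ − J·B) + (JᴴJ − 1)·B`. [folklore] -/
theorem adjoint_split {α β γ : Type*} [Fintype α] [Fintype β] [DecidableEq β] (J : Matrix α β ℂ) (B : Matrix β γ ℂ)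
    (B' : Matrix α γ ℂ) : Jᴴ * B' - B = Jᴴ * (B' - J * B) + (Jᴴ * J - 1) * B := by
  rw [Matrix.mul_sub, Matrix.sub_mul, Matrix.one_mul, ← Matrix.mul_assoc]
  abel

omit [NeZero L] in
/-- `0 ≤ 1 − L⁻¹` (`1 ≤ L`). [folklore] -/
theorem one_sub_inv_nonneg (hL : 1 ≤ L) : 0 ≤ 1 - (L : ℝ)⁻¹ := by
  rw [sub_nonneg]
  exact inv_le_one_of_one_le₀ (by exact_mod_cast hL)

/-- **THE ADJOINT SPLIT IN NORM**: `‖JᴴB′ − B‖ ≤ ‖B′ − J·B‖ + (1 − L⁻¹)·‖P_def·B‖` for King's compressed planting on the star carriers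
and ANY pair of column families `B`, `B′`. [folklore] -/
theorem opNorm_adjoint_defect_le (hL : 1 ≤ L) (k : ℕ) {γ : Type*} [Fintype γ] [DecidableEq γ]
    (B : Matrix (pidx L M (starP L M S) k) γ ℂ) (B' : Matrix (pidx L M (starP L M S) (k + 1)) γ ℂ) :
    ‖(JpR L M (starP L M S) k)ᴴ * B' - B‖
      ≤ ‖B' - JpR L M (starP L M S) k * B‖ + (1 - (L : ℝ)⁻¹) * ‖defP (lev L k) M S * B‖ := by
  have h1 := one_sub_inv_nonneg L hL
  rw [adjoint_split, JpR_conjTranspose_mul_JpR L M S hL k, sub_sub_cancel_left, Matrix.neg_mul, Matrix.smul_mul]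
  refine (norm_add_le _ _).trans (add_le_add ?_ ?_)
  · calc ‖(JpR L M (starP L M S) k)ᴴ * (B' - JpR L M (starP L M S) k * B)‖
        ≤ ‖(JpR L M (starP L M S) k)ᴴ‖ * ‖B' - JpR L M (starP L M S) k * B‖ := Matrix.l2_opNorm_mul _ _
      _ ≤ 1 * ‖B' - JpR L M (starP L M S) k * B‖ := by
          refine mul_le_mul_of_nonneg_right ?_ (norm_nonneg _)
          rw [Matrix.l2_opNorm_conjTranspose]; exact opNorm_JpR_le L M (starP L M S) k
      _ = ‖B' - JpR L M (starP L M S) k * B‖ := one_mul _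
  · rw [norm_neg, norm_smul, Complex.norm_real, Real.norm_of_nonneg h1]

end Algebra

/-! ## §2 The deficient-layer trace of the gauge columns on a coordinate box -/

section Trace

variable (n : ℕ) [NeZero n] (M : Fin d → ℕ) [hM : ∀ μ, NeZero (M μ)] (S : Tor M → Prop) [DecidablePred S] (a' : ℝ)

/-- the zero-extended scalar box solution with source `Q′_Ωᴴc`: `ψ̄_c = ext(G′_Ω·Q′_Ωᴴc)`. [folklore] -/
def psiBar (c : {y // S y} → ℂ) : Tor (fine n M) → ℂ := solExt n M a' (blockReg n M S) ((QOm n M S)ᴴ *ᵥ c)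

/-- `√(n^d)·∂ψ̄_c` read on ALL bonds. [folklore] -/
def colU (c : {y // S y} → ℂ) : Tor (fine n M) × Fin d → ℂ := fun bb =>
  (((Real.sqrt ((n : ℝ) ^ d)) : ℝ) : ℂ) * (GradOp (fine n M) (n : ℂ) *ᵥ psiBar n M S a' c) bb

/-- **`B̂c = √(n^d)·∂ψ̄_c`** on the star bonds. [folklore] -/
theorem regionBh_mulVec_apply (c : {y // S y} → ℂ) (b : {b // starReg n M S b}) :
    (regionBh n M a' S *ᵥ c) b = colU n M S a' c b.1 := by
  unfold regionBh gaugeB colU psiBar solExt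
  rw [Matrix.smul_mulVec, Pi.smul_apply, smul_eq_mul, ← Matrix.mulVec_mulVec, ← Matrix.mulVec_mulVec, gradR_mulVec]
  rfl

/-- `Σ_bonds ‖colU‖² = n^d·Σ_μ ‖∂_μψ̄‖²`. [folklore] -/
theorem sum_normSq_colU (c : {y // S y} → ℂ) :
    ∑ bb, ‖colU n M S a' c bb‖ ^ 2 = (n : ℝ) ^ d * ∑ μ, nsq (sdiff (fine n M) (n : ℂ) μ *ᵥ psiBar n M S a' c) := by
  have hn : (0 : ℝ) ≤ (n : ℝ) ^ d := pow_nonneg (Nat.cast_nonneg n) d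
  rw [Fintype.sum_prod_type, Finset.mul_sum, Finset.sum_comm]
  refine Finset.sum_congr rfl fun μ _ => ?_
  unfold nsq
  rw [Finset.mul_sum]
  refine Finset.sum_congr rfl fun x _ => ?_
  rw [colU, GradOp_mulVec, norm_mul, mul_pow, Complex.norm_real, Real.norm_of_nonneg (Real.sqrt_nonneg _), Real.sq_sqrt hn]

/-- **UP THE COLUMN, CONSECUTIVE DIFFERENCES OF `√(n^d)·∂_νψ̄` ARE DIAGONAL SECOND DIFFERENCES**:
`n·(U(y + e_ν, ν) − U(y, ν)) = −√(n^d)·(∂_νᴴ∂_ν ψ̄)(y + e_ν)`. [folklore] -/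
theorem colU_step (c : {y // S y} → ℂ) (y : Tor (fine n M)) (ν : Fin d) :
    (n : ℂ) * (colU n M S a' c (y + unitVec (fine n M) ν, ν) - colU n M S a' c (y, ν))
      = -((((Real.sqrt ((n : ℝ) ^ d)) : ℝ) : ℂ) * (Pdir (fine n M) (n : ℂ) ν *ᵥ psiBar n M S a' c) (y + unitVec (fine n M) ν)) := by
  rw [colU, colU, GradOp_mulVec, GradOp_mulVec, sdiff_mulVec, sdiff_mulVec, Pdir_mulVec, add_sub_cancel_right,
    Complex.conj_natCast]
  ring

/-- the interior diagonal second-difference energy read on all bonds: `[x ∈ Ω]·‖(∂_μᴴ∂_μψ̄)(x)‖²`. [folklore] -/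
def colF (c : {y // S y} → ℂ) (bb : Tor (fine n M) × Fin d) : ℝ :=
  if blockReg n M S bb.1 then ‖(Pdir (fine n M) (n : ℂ) bb.2 *ᵥ psiBar n M S a' c) bb.1‖ ^ 2 else 0

/-- `0 ≤ colF`. [folklore] -/
theorem colF_nonneg (c : {y // S y} → ℂ) (bb : Tor (fine n M) × Fin d) : 0 ≤ colF n M S a' c bb := by
  unfold colF; split_ifs <;> positivity

/-- `Σ_bonds colF = Σ_μ Σ_{x∈Ω} ‖(∂_μᴴ∂_μψ̄)(x)‖²`. [folklore] -/
theorem sum_colF (c : {y // S y} → ℂ) :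
    ∑ bb, colF n M S a' c bb = ∑ μ, ∑ x ∈ univ.filter (blockReg n M S), ‖(Pdir (fine n M) (n : ℂ) μ *ᵥ psiBar n M S a' c) x‖ ^ 2 := by
  rw [Fintype.sum_prod_type, Finset.sum_comm]
  refine Finset.sum_congr rfl fun μ _ => ?_
  rw [Finset.sum_filter]
  rfl

/-- **ONE SPIKE**: for a deficient star bond `b = (x, ν)`,
`n·‖B̂c(b)‖² ≤ 2·Σ_{s<n} ‖U(x + s e_ν, ν)‖² + n^d·Σ_{s<n} colF(x + s e_ν, ν)`. [folklore] -/
theorem spike_le (c : {y // S y} → ℂ) (b : {b // starReg n M S b}) (hx : ¬ blockReg n M S b.1.1) :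
    (n : ℝ) * ‖(regionBh n M a' S *ᵥ c) b‖ ^ 2
      ≤ 2 * ∑ s ∈ range n, ‖colU n M S a' c (cpt n M b.1 s)‖ ^ 2 + (n : ℝ) ^ d * ∑ s ∈ range n, colF n M S a' c (cpt n M b.1 s) := by
  have hn : (0 : ℝ) ≤ (n : ℝ) ^ d := pow_nonneg (Nat.cast_nonneg n) d
  have hp := path_avg (fun s => colU n M S a' c (cpt n M b.1 s)) n
  beta_reduce at hp
  have h0 : colU n M S a' c (cpt n M b.1 0) = (regionBh n M a' S *ᵥ c) b := by
    rw [regionBh_mulVec_apply]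
    show colU n M S a' c (b.1.1 + tstep (fine n M) b.1.2 0, b.1.2) = colU n M S a' c b.1
    rw [tstep_zero, add_zero]
  rw [h0] at hp
  -- a shifted partial sum of nonnegative terms is dominated by the full sum
  have hshift : ∀ G : ℕ → ℝ, (∀ s, 0 ≤ G s) → ∑ r ∈ range (n - 1), G (r + 1) ≤ ∑ s ∈ range n, G s := by
    intro G hG
    obtain ⟨m, hm⟩ : ∃ m, n = m + 1 := ⟨n - 1, (Nat.succ_pred_eq_of_pos (Nat.pos_of_ne_zero (NeZero.ne n))).symm⟩
    rw [hm, Nat.add_sub_cancel, Finset.sum_range_succ']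
    exact le_add_of_nonneg_right (hG 0)
  -- the consecutive differences up the column are the interior diagonal second differences
  have hdiff : ∀ r ∈ range (n - 1),
      (n : ℝ) ^ 2 * ‖colU n M S a' c (cpt n M b.1 (r + 1)) - colU n M S a' c (cpt n M b.1 r)‖ ^ 2
        = (n : ℝ) ^ d * colF n M S a' c (cpt n M b.1 (r + 1)) := by
    intro r hr
    have hr' : r < n := by have := mem_range.mp hr; omega
    have hin : blockReg n M S (cpt n M b.1 (r + 1)).1 := blockReg_add_tstep_succ n M S b.2 hx hr'
    have e1 : cpt n M b.1 (r + 1) = ((cpt n M b.1 r).1 + unitVec (fine n M) b.1.2, b.1.2) := by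
      show (b.1.1 + tstep (fine n M) b.1.2 (r + 1), b.1.2) = (b.1.1 + tstep (fine n M) b.1.2 r + unitVec (fine n M) b.1.2, b.1.2)
      rw [tstep_succ, add_assoc]
    have key : (n : ℂ) * (colU n M S a' c (cpt n M b.1 (r + 1)) - colU n M S a' c (cpt n M b.1 r))
        = -((((Real.sqrt ((n : ℝ) ^ d)) : ℝ) : ℂ) * (Pdir (fine n M) (n : ℂ) b.1.2 *ᵥ psiBar n M S a' c) (cpt n M b.1 (r + 1)).1) := by
      rw [e1]
      exact colU_step n M S a' c (cpt n M b.1 r).1 b.1.2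
    have hnorm : (n : ℝ) * ‖colU n M S a' c (cpt n M b.1 (r + 1)) - colU n M S a' c (cpt n M b.1 r)‖
        = Real.sqrt ((n : ℝ) ^ d) * ‖(Pdir (fine n M) (n : ℂ) b.1.2 *ᵥ psiBar n M S a' c) (cpt n M b.1 (r + 1)).1‖ := by
      have := congrArg (fun z : ℂ => ‖z‖) key
      simp only [norm_mul, Complex.norm_natCast, norm_neg, Complex.norm_real, Real.norm_of_nonneg (Real.sqrt_nonneg _)] at this
      exact this
    rw [colF, if_pos hin, show (cpt n M b.1 (r + 1)).2 = b.1.2 from rfl, ← mul_pow, hnorm, mul_pow, Real.sq_sqrt hn]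
  have hsum : (n : ℝ) ^ 2 * ∑ r ∈ range (n - 1), ‖colU n M S a' c (cpt n M b.1 (r + 1)) - colU n M S a' c (cpt n M b.1 r)‖ ^ 2
      ≤ (n : ℝ) ^ d * ∑ s ∈ range n, colF n M S a' c (cpt n M b.1 s) := by
    rw [Finset.mul_sum, Finset.sum_congr rfl hdiff, ← Finset.mul_sum]
    exact mul_le_mul_of_nonneg_left (hshift (fun s => colF n M S a' c (cpt n M b.1 s)) fun s => colF_nonneg n M S a' c _) hn
  linarith

/-- `n^d·‖Q′_Ωᴴ c‖² ≤ ‖c‖²`. [folklore] -/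
theorem nsq_QOm_conjTranspose_mulVec_le (c : {y // S y} → ℂ) : (n : ℝ) ^ d * nsq ((QOm n M S)ᴴ *ᵥ c) ≤ nsq c := by
  have hn : (0 : ℝ) < (n : ℝ) ^ d := pow_pos (by exact_mod_cast Nat.pos_of_ne_zero (NeZero.ne n)) d
  have h1 : ‖(QOm n M S)ᴴ‖ ^ 2 ≤ ((n : ℝ) ^ d)⁻¹ := by
    rw [Matrix.l2_opNorm_conjTranspose]
    calc ‖QOm n M S‖ ^ 2 ≤ ((Real.sqrt ((n : ℝ) ^ d))⁻¹) ^ 2 := pow_le_pow_left₀ (norm_nonneg _) (opNorm_QOm_le n M S) 2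
      _ = ((n : ℝ) ^ d)⁻¹ := by rw [inv_pow, Real.sq_sqrt hn.le]
  have h2 := nsq_mulVec_le_rect ((QOm n M S)ᴴ) c
  calc (n : ℝ) ^ d * nsq ((QOm n M S)ᴴ *ᵥ c) ≤ (n : ℝ) ^ d * (((n : ℝ) ^ d)⁻¹ * nsq c) :=
        mul_le_mul_of_nonneg_left (h2.trans (mul_le_mul_of_nonneg_right h1 (nsq_nonneg c))) hn.le
    _ = nsq c := by rw [← mul_assoc, mul_inv_cancel₀ hn.ne', one_mul]

/-- **THE DEFICIENT-LAYER TRACE OF THE GAUGE COLUMNS** on a coordinate box: `Σ_def ‖B̂c‖² ≤ 2Λ·‖c‖²/n`. [folklore] -/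
theorem sum_deficient_normSq_regionBh_le (hS : IsCoordBox M S) (ha' : 0 < a') (c : {y // S y} → ℂ) :
    ∑ b ∈ defSet n M S, ‖(regionBh n M a' S *ᵥ c) b‖ ^ 2 ≤ 2 * Lam d a' * nsq c / n := by
  have hn0 : (0 : ℝ) < n := by exact_mod_cast Nat.pos_of_ne_zero (NeZero.ne n)
  have hnd : (0 : ℝ) ≤ (n : ℝ) ^ d := pow_nonneg (Nat.cast_nonneg n) d
  rw [le_div_iff₀ hn0, Finset.sum_mul]
  -- sum the spikes
  have h1 : ∑ b ∈ defSet n M S, ‖(regionBh n M a' S *ᵥ c) b‖ ^ 2 * n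
      ≤ ∑ b ∈ defSet n M S, (2 * ∑ s ∈ range n, ‖colU n M S a' c (cpt n M b.1 s)‖ ^ 2
          + (n : ℝ) ^ d * ∑ s ∈ range n, colF n M S a' c (cpt n M b.1 s)) :=
    sum_le_sum fun b hb => by rw [mul_comm]; exact spike_le n M S a' c b ((mem_defSet n M S).mp hb)
  -- the columns are disjoint
  have h2 : ∑ b ∈ defSet n M S, ∑ s ∈ range n, ‖colU n M S a' c (cpt n M b.1 s)‖ ^ 2
      ≤ (n : ℝ) ^ d * ∑ μ, nsq (sdiff (fine n M) (n : ℂ) μ *ᵥ psiBar n M S a' c) := by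
    rw [← sum_normSq_colU]
    exact sum_columns_le n M S (fun bb => ‖colU n M S a' c bb‖ ^ 2) fun bb => by positivity
  have h3 : ∑ b ∈ defSet n M S, ∑ s ∈ range n, colF n M S a' c (cpt n M b.1 s)
      ≤ ∑ μ, ∑ x ∈ univ.filter (blockReg n M S), ‖(Pdir (fine n M) (n : ℂ) μ *ᵥ psiBar n M S a' c) x‖ ^ 2 := by
    rw [← sum_colF]
    exact sum_columns_le n M S (colF n M S a' c) (colF_nonneg n M S a' c)
  -- gan24's budget of the zero-extended box solution on a corner-free block region
  have h4 : ∑ μ, budget M S n μ (psiBar n M S a' c) ≤ Lam d a' * nsq ((QOm n M S)ᴴ *ᵥ c) :=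
    sum_budget_solExt_le M S hS n ha' (blockReg n M S) (fun _ => Iff.rfl) ((QOm n M S)ᴴ *ᵥ c)
  have h5 : ∑ μ, budget M S n μ (psiBar n M S a' c) = ∑ μ, nsq (sdiff (fine n M) (n : ℂ) μ *ᵥ psiBar n M S a' c)
      + ∑ μ, ∑ x ∈ univ.filter (blockReg n M S), ‖(Pdir (fine n M) (n : ℂ) μ *ᵥ psiBar n M S a' c) x‖ ^ 2 := by
    rw [← Finset.sum_add_distrib]; rfl
  have h6 := nsq_QOm_conjTranspose_mulVec_le n M S c
  have hΛ := Lam_nonneg (d := d) a'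
  rw [sum_add_distrib, ← mul_sum, ← mul_sum] at h1
  have h7 : (n : ℝ) ^ d * (Lam d a' * nsq ((QOm n M S)ᴴ *ᵥ c)) ≤ Lam d a' * nsq c := by
    rw [mul_left_comm]; exact mul_le_mul_of_nonneg_left h6 hΛ
  -- abbreviations and the final (linear) bookkeeping
  set A := ∑ b ∈ defSet n M S, ∑ s ∈ range n, ‖colU n M S a' c (cpt n M b.1 s)‖ ^ 2 with hA
  set B := ∑ b ∈ defSet n M S, ∑ s ∈ range n, colF n M S a' c (cpt n M b.1 s) with hB
  set D := ∑ μ, nsq (sdiff (fine n M) (n : ℂ) μ *ᵥ psiBar n M S a' c) with hD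
  set H := ∑ μ, ∑ x ∈ univ.filter (blockReg n M S), ‖(Pdir (fine n M) (n : ℂ) μ *ᵥ psiBar n M S a' c) x‖ ^ 2 with hH
  have hH0 : 0 ≤ H := sum_nonneg fun μ _ => sum_nonneg fun x _ => by positivity
  have hDH : D + H ≤ Lam d a' * nsq ((QOm n M S)ᴴ *ᵥ c) := by have h := h4; rw [h5] at h; exact h
  have h8 : (n : ℝ) ^ d * D + (n : ℝ) ^ d * H ≤ (n : ℝ) ^ d * (Lam d a' * nsq ((QOm n M S)ᴴ *ᵥ c)) := by
    rw [← mul_add]; exact mul_le_mul_of_nonneg_left hDH hnd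
  have h9 : (n : ℝ) ^ d * B ≤ (n : ℝ) ^ d * H := mul_le_mul_of_nonneg_left h3 hnd
  have h10 : 0 ≤ (n : ℝ) ^ d * H := mul_nonneg hnd hH0
  linarith [h1, h2, h7, h8, h9, h10]

/-- **`‖P_def·B̂‖ ≤ √(2Λ/n)`** on a coordinate box (`Λ = Lam d a′`). [folklore] -/
theorem opNorm_defP_mul_regionBh_le (hS : IsCoordBox M S) (ha' : 0 < a') :
    ‖defP n M S * regionBh n M a' S‖ ≤ Real.sqrt (2 * Lam d a' / n) := by
  have hn0 : (0 : ℝ) < n := by exact_mod_cast Nat.pos_of_ne_zero (NeZero.ne n)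
  have hΛ := Lam_nonneg (d := d) a'
  refine opNorm_le_of_nsq_le_rect _ (Real.sqrt_nonneg _) fun c => ?_
  rw [Real.sq_sqrt (by positivity), ← Matrix.mulVec_mulVec, nsq_defP_mulVec]
  have h := sum_deficient_normSq_regionBh_le n M S a' hS ha' c
  calc ∑ b ∈ defSet n M S, ‖(regionBh n M a' S *ᵥ c) b‖ ^ 2 ≤ 2 * Lam d a' * nsq c / n := h
    _ = 2 * Lam d a' / n * nsq c := by ring

end Trace

/-! ## §3 Along the star tower on a coordinate box: (Bᵗ) from (B), and the END modulo (L) (B) (K) -/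

section Tower

variable (L : ℕ) [NeZero L] (M : Fin d → ℕ) [hM : ∀ μ, NeZero (M μ)] (S : Tor M → Prop) [DecidablePred S] (a a' : ℝ)

/-- the trace term along the tower: `‖P_def·B̂_k‖ ≤ √(2Λ)·((√L)⁻¹)^k`. [folklore] -/
theorem opNorm_defP_mul_regionBh_le_lev (hS : IsCoordBox M S) (ha' : 0 < a') (k : ℕ) :
    ‖defP (lev L k) M S * regionBh (lev L k) M a' S‖ ≤ Real.sqrt (2 * Lam d a') * ((Real.sqrt L)⁻¹) ^ k := by
  have hΛ : 0 ≤ 2 * Lam d a' := by have := Lam_nonneg (d := d) a'; positivity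
  refine (opNorm_defP_mul_regionBh_le (lev L k) M S a' hS ha').trans (le_of_eq ?_)
  rw [div_eq_mul_inv, Real.sqrt_mul hΛ, sqrt_inv_lev L k]

/-- the (Bᵗ) constant from the (B) constant: `Cbt = Cb + (1 − L⁻¹)·√(2Λ)`. [folklore] -/
def Cbt (d L : ℕ) (a' Cb : ℝ) : ℝ := Cb + (1 - (L : ℝ)⁻¹) * Real.sqrt (2 * Lam d a')

/-- **LEAF (Bᵗ) FROM LEAF (B)** on a coordinate box at every rate `θ ≥ (√L)⁻¹`:
`‖B̂_{k+1} − J_k·B̂_k‖ ≤ Cb·θ^k` ⟹ `‖J_kᴴ·B̂_{k+1} − B̂_k‖ ≤ (Cb + (1 − L⁻¹)√(2Λ))·θ^k` — the owner's `hBt` VERBATIM. [folklore] -/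
theorem hBt_of_hB (hL : 1 ≤ L) (hS : IsCoordBox M S) (ha' : 0 < a') {θ Cb : ℝ} (hθ : (Real.sqrt L)⁻¹ ≤ θ)
    (hB : ∀ k, ‖regionBh (lev L (k + 1)) M a' S - JpR L M (starP L M S) k * regionBh (lev L k) M a' S‖ ≤ Cb * θ ^ k) (k : ℕ) :
    ‖(JpR L M (starP L M S) k)ᴴ * regionBh (lev L (k + 1)) M a' S - regionBh (lev L k) M a' S‖ ≤ Cbt d L a' Cb * θ ^ k := by
  have h1 := one_sub_inv_nonneg L hL
  have hs0 : 0 ≤ (Real.sqrt L)⁻¹ := inv_nonneg.mpr (Real.sqrt_nonneg _)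
  have htr := opNorm_defP_mul_regionBh_le_lev L M S a' hS ha' k
  have hpow : ((Real.sqrt L)⁻¹) ^ k ≤ θ ^ k := pow_le_pow_left₀ hs0 hθ k
  calc ‖(JpR L M (starP L M S) k)ᴴ * regionBh (lev L (k + 1)) M a' S - regionBh (lev L k) M a' S‖
      ≤ ‖regionBh (lev L (k + 1)) M a' S - JpR L M (starP L M S) k * regionBh (lev L k) M a' S‖
          + (1 - (L : ℝ)⁻¹) * ‖defP (lev L k) M S * regionBh (lev L k) M a' S‖ :=
        opNorm_adjoint_defect_le L M S hL k _ _
    _ ≤ Cb * θ ^ k + (1 - (L : ℝ)⁻¹) * (Real.sqrt (2 * Lam d a') * θ ^ k) := by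
        gcongr
        · exact hB k
        · exact htr.trans (mul_le_mul_of_nonneg_left hpow (Real.sqrt_nonneg _))
    _ = Cbt d L a' Cb * θ ^ k := by unfold Cbt; ring

/-- **`hinjK` ON A COORDINATE BOX FROM THE THREE LEAVES (L) (B) (K)** at rate `θ ≥ (√L)⁻¹` (`2 ≤ L`, `0 < a`, `0 < a′`, `0 ≤ Cb`):
the owner's `hinjK_of_local` with (Bᵗ) discharged by `hBt_of_hB`. [folklore] -/
theorem hinjK_of_local3 (hL : 2 ≤ L) (hbox : IsCoordBox M S) (ha : 0 < a) (ha' : 0 < a') {θ Cl Cb Ck : ℝ}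
    (hθ : (Real.sqrt L)⁻¹ ≤ θ) (hCb : 0 ≤ Cb)
    (hloc : ∀ k, ‖(regionDeltaLoc (lev L (k + 1)) M a S)⁻¹ * JpR L M (starP L M S) k
        - JpR L M (starP L M S) k * (regionDeltaLoc (lev L k) M a S)⁻¹‖ ≤ Cl * θ ^ k)
    (hB : ∀ k, ‖regionBh (lev L (k + 1)) M a' S - JpR L M (starP L M S) k * regionBh (lev L k) M a' S‖ ≤ Cb * θ ^ k)
    (hK : ∀ k, ‖(KcompR (lev L (k + 1)) M a' S)⁻¹ - (KcompR (lev L k) M a' S)⁻¹‖ ≤ Ck * θ ^ k) (k : ℕ) :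
    ‖(regionDeltaA (lev L (k + 1)) M a a' S)⁻¹ * JpR L M (starP L M S) k
        - JpR L M (starP L M S) k * (regionDeltaA (lev L k) M a a' S)⁻¹‖ ≤ C1loc d a a' Cl Cb (Cbt d L a' Cb) Ck * θ ^ k :=
  hinjK_of_local L M S a a' hL hbox ha ha' (le_trans (inv_nonneg.mpr (Real.sqrt_nonneg _)) hθ) hCb hloc hB
    (hBt_of_hB L M S a' (le_trans (by norm_num) hL) hbox ha' hθ hB) hK k

/-- **THE RENORMALISED STAR TOWER OF THE FAITHFUL `Δ_a(Ω₀)` ON A COORDINATE BOX AT RATE `θ ∈ [(√L)⁻¹, 1)` MODULO THE THREE LEAVES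
(L) (B) (K)** — the owner's `towerLimitRate_star_renorm_box_of_local` with (Bᵗ) DISCHARGED (`Cbt = Cb + (1 − L⁻¹)√(2Λ)`). [folklore] -/
theorem towerLimitRate_star_renorm_box_of_local3 (hL : 2 ≤ L) (hbox : IsCoordBox M S) (ha : 0 < a) (ha' : 0 < a')
    {θ Cl Cb Ck : ℝ} (hθ : (Real.sqrt L)⁻¹ ≤ θ) (hθ1 : θ < 1) (hCb : 0 ≤ Cb)
    (hloc : ∀ k, ‖(regionDeltaLoc (lev L (k + 1)) M a S)⁻¹ * JpR L M (starP L M S) k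
        - JpR L M (starP L M S) k * (regionDeltaLoc (lev L k) M a S)⁻¹‖ ≤ Cl * θ ^ k)
    (hB : ∀ k, ‖regionBh (lev L (k + 1)) M a' S - JpR L M (starP L M S) k * regionBh (lev L k) M a' S‖ ≤ Cb * θ ^ k)
    (hK : ∀ k, ‖(KcompR (lev L (k + 1)) M a' S)⁻¹ - (KcompR (lev L k) M a' S)⁻¹‖ ≤ Ck * θ ^ k) :
    TowerLimitRate (AnR L M (starP L M S)) ((L : ℝ) ^ d) (fun k => (regionDeltaA (lev L k) M a a' S)⁻¹)
      (Cpert 0 (Real.sqrt (CgIbox d a' (cW1box d a a' 4) / 2 * (gamStar d a' (cW1box d a a' 4))⁻¹))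
        (Real.sqrt L * C1loc d a a' Cl Cb (Cbt d L a' Cb) Ck + (2 * (Real.sqrt L - 1) * Real.sqrt ((2 * (gamStar d a' (cW1box d a a' 4))⁻¹
          + CgIbox d a' (cW1box d a a' 4)) * (gamStar d a' (cW1box d a a' 4))⁻¹))) 0 0 0) θ :=
  towerLimitRate_star_renorm_box_of_local L M S a a' hL hbox ha ha' hθ hθ1 hCb hloc hB
    (hBt_of_hB L M S a' (le_trans (by norm_num) hL) hbox ha' hθ hB) hK

end Tower

end Summit.QuantumFields.BalabanUV.T4Continuum.RegionGaugeColumnsTrace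

end
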